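import Literature.MathematicalPhysics.QuantumLattice.TorusSectorPartitionFnTwoScaleTiling
import Literature.MathematicalPhysics.QuantumLattice.TorusSectorPartitionFnMixedTiling
import HarnessLib

/-!
# Two open `a × a` box partition functions bound the canonical free energy of EVERY large torus at
# every filling between the box densities (finite volume, `O(L)` defect)

Family `hubbard` (topic `MathematicalPhysics/QuantumLattice`; continuation of `TorusSectorPartitionFnMixedTiling`
(the torus `Ka × Ka` — box-built tori only) by means of `TorusSectorPartitionFnTwoScaleTiling` (blocks of two
side lengths `a`, `a + 1` tile the torus `L × L`, `L = (K − r)·a + r·(a+1)`; an open box dominates its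
sub-boxes)). Written for the free-energy route of the `T > 0` certificate family (Hubbard material-oracle
programme, filling leg of BOX → WORD): it removes the restriction of the producers to box-built tori, so
that they bind EVERY torus limit of the thermal convention of record (`∀ Ls → ∞`).

* §1 `pow_mul_pow_partitionFn_openBox_le_rectTorus_allTori` — for `L = (K − r)·a + r·(a+1)` (`K − r ≥ 2`,
  `r ≤ K`, `a ≥ 1`), box sectors `p, q` and every `m ≤ K²`:
  `Re Z_β(box_{a×a}; q,q)^m · Re Z_β(box_{a×a}; p,p)^{K²−m} ≤ Re Z_β(torus_{L×L}; (K²−m)p + mq, (K²−m)p + mq)` — the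
  `K²` blocks of the four shapes `a×a`, `a×(a+1)`, `(a+1)×a`, `(a+1)×(a+1)` carry `p` or `q` electrons per
  spin, and each block partition function dominates the `a × a` one with the same electrons;
  logarithmic form `mul_log_add_mul_log_partitionFn_openBox_le_rectTorus_allTori`.
* §2 bookkeeping of `L = Ka + r`: `exists_twoScale_decomposition` (`a(a+1) ≤ L ⇒ L = (K−r)a + r(a+1)` with
  `K = L/a`, `r = L mod a`, `K − r ≥ 2`), the block count versus the area
  (`sq_div_le`, `sq_sub_le_div_sq` : `K² a² ≤ L²`, `L²/a² − 2L/a ≤ K²`), and the sector range at a filling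
  `n ∈ [2p/a², 2(p+1)/a²)`: `sq_div_mul_le_halfRectN` (every `L`) and
  `eventually_halfRectN_le_sq_div_mul_succ` (all large `L`, strict upper density).
* §3 **`chord_mul_sq_sub_linear_le_log_partitionFn_sectorHamiltonianTT'`** — for every such `L` and every
  filling with `K²p ≤ halfRectN n L ≤ K²(p+1)`, certified floors `0 < z_p ≤ Re Z_β(box; p,p)`,
  `0 < z_q ≤ Re Z_β(box; p+1,p+1)`:
  `chord(n)·L² − (2/a)|log z_p − p(log z_q − log z_p)|·L − |log z_q − log z_p| ≤ log Re Z_β(sectorHamiltonianTT' t t' U n L)`,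
  `chord(n) = (log z_p + (na²/2 − p)(log z_q − log z_p))/a²` — an `O(L)` defect, absorbed per volume.

Everything is PROVED; no definition, no named fact.

## References

* D. Ruelle, *Statistical Mechanics: Rigorous Results* (1969), §3.3 eqs. (3.11)–(3.18) (sub-boxes of two sizes
  and different particle numbers; defects absorbed per volume), §3.4.3. [cite: Ruelle1969, §3.3 (3.11)–(3.18)]
* R. B. Israel, *Convexity in the Theory of Lattice Gases* (1979), Lemma II.3.1. [cite: Israel1979, Lemma II.3.1]
* J. P. F. LeBlanc et al., Phys. Rev. X 5 (2015) 041041, eq. (1). [cite: LeBlancEtAl2015, eq. (1)]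
-/

noncomputable section

namespace Literature.MathematicalPhysics.QuantumLattice

open Matrix Finset HubbardWave0 ThermodynamicLimit LiebThm1
open _root_.Filter
open scoped _root_.Topology ComplexOrder BigOperators

/-! ### §1 Every large torus: the mixed two-box bound -/

section AllTori

/-- **Two open `a × a` box partition functions bound EVERY large torus** (canonical `t–t'` Hubbard torus
`L × L`, `L = (K − r)·a + r·(a + 1)` with `K − r ≥ 2`, `r ≤ K`, `a ≥ 1`; `β ≥ 0`): for box sectors `p, q` and
every `m ≤ K²`,
`Re Z_β(box; q,q)^m · Re Z_β(box; p,p)^{K²−m} ≤ Re Z_β(torus_{L×L}; (K²−m)p + mq, (K²−m)p + mq)`,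
`box = hubbardOpenBoxTT' a a t t' U` — `K²` blocks of the shapes `a×a`, `a×(a+1)`, `(a+1)×a`, `(a+1)×(a+1)`,
`m` of them with `q` electrons per spin, each dominating the `a × a` box with the same electrons.
[cite: Ruelle1969, §3.3 (3.11)–(3.18)] -/
theorem pow_mul_pow_partitionFn_openBox_le_rectTorus_allTori (a K r : ℕ) (hK : 2 ≤ K - r) (hrK : r ≤ K)
    (ha : 1 ≤ a) (t t' U : ℝ) {β : ℝ} (hβ : 0 ≤ β) (p q : ℕ) {m : ℕ} (hm : m ≤ K * K) :
    (partitionFn β (spinSectorHamiltonian q q (hubbardOpenBoxTT' a a t t' U))).re ^ m *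
        (partitionFn β (spinSectorHamiltonian p p (hubbardOpenBoxTT' a a t t' U))).re ^ (K * K - m) ≤
      (partitionFn β (spinSectorHamiltonian ((K * K - m) * p + m * q) ((K * K - m) * p + m * q)
        (hubbardRectTorusTT' ((K - r) * a + r * (a + 1)) ((K - r) * a + r * (a + 1)) t t' U))).re := by
  classical
  set u := K - r with hu
  have huv : u + r = K := by rw [hu]; omega
  -- the global block index set and the colouring
  have hcard : Fintype.card ((Fin u ⊕ Fin r) × (Fin u ⊕ Fin r)) = K * K := by
    simp only [Fintype.card_prod, Fintype.card_sum, Fintype.card_fin, huv]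
  obtain ⟨s, -, hs⟩ : ∃ s : Finset ((Fin u ⊕ Fin r) × (Fin u ⊕ Fin r)), s ⊆ univ ∧ s.card = m :=
    Finset.exists_subset_card_eq (by rw [Finset.card_univ, hcard]; exact hm)
  set g : (Fin u ⊕ Fin r) × (Fin u ⊕ Fin r) → ℕ := fun x => if x ∈ s then q else p with hg
  set F : ℕ → ℝ := fun σ => (partitionFn β (spinSectorHamiltonian σ σ (hubbardOpenBoxTT' a a t t' U))).re
    with hF
  have hFnn : ∀ σ, 0 ≤ F σ := fun σ =>
    partitionFn_spinSector_re_nonneg _ _ (hubbardOpenBoxTT'_isHermitian a a t t' U) β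
  -- the tiling bound with the four block families
  have htile := prod_partitionFn_openBox_twoScale_le_rectTorus u a r (a + 1) u a r (a + 1) hK hK ha ha t t' U hβ
    (fun i j => g (Sum.inl i, Sum.inl j)) (fun i j => g (Sum.inl i, Sum.inl j))
    (fun i j => g (Sum.inl i, Sum.inr j)) (fun i j => g (Sum.inl i, Sum.inr j))
    (fun i j => g (Sum.inr i, Sum.inl j)) (fun i j => g (Sum.inr i, Sum.inl j))
    (fun i j => g (Sum.inr i, Sum.inr j)) (fun i j => g (Sum.inr i, Sum.inr j))
  -- each block dominates the `a × a` box with the same electrons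
  have hmono : (∏ i : Fin u, ∏ j : Fin u, F (g (Sum.inl i, Sum.inl j))) *
      (∏ i : Fin u, ∏ j : Fin r, F (g (Sum.inl i, Sum.inr j))) *
      ((∏ i : Fin r, ∏ j : Fin u, F (g (Sum.inr i, Sum.inl j))) *
        (∏ i : Fin r, ∏ j : Fin r, F (g (Sum.inr i, Sum.inr j)))) ≤
      (∏ i : Fin u, ∏ j : Fin u, (partitionFn β (spinSectorHamiltonian (g (Sum.inl i, Sum.inl j))
          (g (Sum.inl i, Sum.inl j)) (hubbardOpenBoxTT' a a t t' U))).re) *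
      (∏ i : Fin u, ∏ j : Fin r, (partitionFn β (spinSectorHamiltonian (g (Sum.inl i, Sum.inr j))
          (g (Sum.inl i, Sum.inr j)) (hubbardOpenBoxTT' a (a + 1) t t' U))).re) *
      ((∏ i : Fin r, ∏ j : Fin u, (partitionFn β (spinSectorHamiltonian (g (Sum.inr i, Sum.inl j))
          (g (Sum.inr i, Sum.inl j)) (hubbardOpenBoxTT' (a + 1) a t t' U))).re) *
        (∏ i : Fin r, ∏ j : Fin r, (partitionFn β (spinSectorHamiltonian (g (Sum.inr i, Sum.inr j))
          (g (Sum.inr i, Sum.inr j)) (hubbardOpenBoxTT' (a + 1) (a + 1) t t' U))).re)) := by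
    have hP : ∀ {ι : Type} (S : Finset ι) (f₁ f₂ : ι → ℝ), (∀ i ∈ S, 0 ≤ f₁ i) → (∀ i ∈ S, f₁ i ≤ f₂ i) →
        ∏ i ∈ S, f₁ i ≤ ∏ i ∈ S, f₂ i := fun S f₁ f₂ h0 h1 => Finset.prod_le_prod h0 h1
    refine mul_le_mul (mul_le_mul (le_of_eq rfl) ?_ ?_ ?_) (mul_le_mul ?_ ?_ ?_ ?_) ?_ ?_
    · exact hP _ _ _ (fun i _ => Finset.prod_nonneg fun j _ => hFnn _) fun i _ =>
        hP _ _ _ (fun j _ => hFnn _) fun j _ => partitionFn_openBox_mono_snd a a 1 t t' U hβ _ _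
    · exact Finset.prod_nonneg fun i _ => Finset.prod_nonneg fun j _ => hFnn _
    · exact Finset.prod_nonneg fun i _ => Finset.prod_nonneg fun j _ => hFnn _
    · exact hP _ _ _ (fun i _ => Finset.prod_nonneg fun j _ => hFnn _) fun i _ =>
        hP _ _ _ (fun j _ => hFnn _) fun j _ => partitionFn_openBox_mono_fst a 1 a t t' U hβ _ _
    · exact hP _ _ _ (fun i _ => Finset.prod_nonneg fun j _ => hFnn _) fun i _ =>
        hP _ _ _ (fun j _ => hFnn _) fun j _ => partitionFn_openBox_mono a 1 a 1 t t' U hβ _ _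
    · exact Finset.prod_nonneg fun i _ => Finset.prod_nonneg fun j _ => hFnn _
    · exact Finset.prod_nonneg fun i _ => Finset.prod_nonneg fun j _ =>
        partitionFn_spinSector_re_nonneg _ _ (hubbardOpenBoxTT'_isHermitian _ _ t t' U) β
    · exact mul_nonneg (Finset.prod_nonneg fun i _ => Finset.prod_nonneg fun j _ => hFnn _)
        (Finset.prod_nonneg fun i _ => Finset.prod_nonneg fun j _ => hFnn _)
    · exact mul_nonneg (Finset.prod_nonneg fun i _ => Finset.prod_nonneg fun j _ =>
          partitionFn_spinSector_re_nonneg _ _ (hubbardOpenBoxTT'_isHermitian _ _ t t' U) β)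
        (Finset.prod_nonneg fun i _ => Finset.prod_nonneg fun j _ =>
          partitionFn_spinSector_re_nonneg _ _ (hubbardOpenBoxTT'_isHermitian _ _ t t' U) β)
  -- the `a × a` product is `F q ^ m · F p ^ (K² − m)`
  have hprod : (∏ i : Fin u, ∏ j : Fin u, F (g (Sum.inl i, Sum.inl j))) *
      (∏ i : Fin u, ∏ j : Fin r, F (g (Sum.inl i, Sum.inr j))) *
      ((∏ i : Fin r, ∏ j : Fin u, F (g (Sum.inr i, Sum.inl j))) *
        (∏ i : Fin r, ∏ j : Fin r, F (g (Sum.inr i, Sum.inr j)))) = ∏ x, F (g x) := by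
    symm
    rw [Fintype.prod_prod_type]
    simp only [Fintype.prod_sum_type, Finset.prod_mul_distrib]
    ring
  have hprod' : ∏ x, F (g x) = F q ^ m * F p ^ (K * K - m) := by
    rw [← Finset.prod_mul_prod_compl s]
    have h1 : ∏ x ∈ s, F (g x) = ∏ x ∈ s, F q :=
      Finset.prod_congr rfl fun x hx => by simp only [hg, if_pos hx]
    have h2 : ∏ x ∈ sᶜ, F (g x) = ∏ x ∈ sᶜ, F p :=
      Finset.prod_congr rfl fun x hx => by simp only [hg, if_neg (Finset.mem_compl.mp hx)]
    rw [h1, h2, Finset.prod_const, Finset.prod_const, hs, Finset.card_compl, hcard, hs]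
  -- the sector totals are `(K² − m) p + m q`
  have hsum : (∑ i : Fin u, (∑ j : Fin u, g (Sum.inl i, Sum.inl j) + ∑ j : Fin r, g (Sum.inl i, Sum.inr j)) +
      ∑ i : Fin r, (∑ j : Fin u, g (Sum.inr i, Sum.inl j) + ∑ j : Fin r, g (Sum.inr i, Sum.inr j))) =
      (K * K - m) * p + m * q := by
    have e : (∑ i : Fin u, (∑ j : Fin u, g (Sum.inl i, Sum.inl j) + ∑ j : Fin r, g (Sum.inl i, Sum.inr j)) +
        ∑ i : Fin r, (∑ j : Fin u, g (Sum.inr i, Sum.inl j) + ∑ j : Fin r, g (Sum.inr i, Sum.inr j))) =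
        ∑ x, g x := by
      symm
      rw [Fintype.sum_prod_type]
      simp only [Fintype.sum_sum_type, Finset.sum_add_distrib]
      ring
    rw [e, ← Finset.sum_add_sum_compl s]
    have h1 : ∑ x ∈ s, g x = ∑ x ∈ s, q := Finset.sum_congr rfl fun x hx => by simp only [hg, if_pos hx]
    have h2 : ∑ x ∈ sᶜ, g x = ∑ x ∈ sᶜ, p :=
      Finset.sum_congr rfl fun x hx => by simp only [hg, if_neg (Finset.mem_compl.mp hx)]
    rw [h1, h2, Finset.sum_const, Finset.sum_const, smul_eq_mul, smul_eq_mul, hs, Finset.card_compl, hcard, hs]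
    ring
  rw [hsum] at htile
  rw [← hprod', ← hprod]
  exact hmono.trans htile

/-- **Logarithmic (free-energy) form on every large torus**, nonempty box sectors `p, q ≤ a²`:
`m·log Re Z_β(box; q,q) + (K²−m)·log Re Z_β(box; p,p) ≤ log Re Z_β(torus_{L×L}; (K²−m)p+mq, (K²−m)p+mq)`,
`L = (K − r)·a + r·(a+1)`. [cite: Ruelle1969, §3.3 (3.11)–(3.18)] [cite: Israel1979, Lemma II.3.1] -/
theorem mul_log_add_mul_log_partitionFn_openBox_le_rectTorus_allTori (a K r : ℕ) (hK : 2 ≤ K - r)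
    (hrK : r ≤ K) (ha : 1 ≤ a) (t t' U : ℝ) {β : ℝ} (hβ : 0 ≤ β) {p q : ℕ} (hp : p ≤ a * a) (hq : q ≤ a * a)
    {m : ℕ} (hm : m ≤ K * K) :
    (m : ℝ) * Real.log (partitionFn β (spinSectorHamiltonian q q (hubbardOpenBoxTT' a a t t' U))).re +
        ((K * K - m : ℕ) : ℝ) *
          Real.log (partitionFn β (spinSectorHamiltonian p p (hubbardOpenBoxTT' a a t t' U))).re ≤
      Real.log (partitionFn β (spinSectorHamiltonian ((K * K - m) * p + m * q) ((K * K - m) * p + m * q)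
        (hubbardRectTorusTT' ((K - r) * a + r * (a + 1)) ((K - r) * a + r * (a + 1)) t t' U))).re := by
  haveI : Nonempty (Subtype (spinConfig (Λ := Fin a ×ₗ Fin a) p p)) :=
    nonempty_spinConfig (by rw [card_rectSites]; exact hp) (by rw [card_rectSites]; exact hp)
  haveI : Nonempty (Subtype (spinConfig (Λ := Fin a ×ₗ Fin a) q q)) :=
    nonempty_spinConfig (by rw [card_rectSites]; exact hq) (by rw [card_rectSites]; exact hq)
  have hp0 : 0 < (partitionFn β (spinSectorHamiltonian p p (hubbardOpenBoxTT' a a t t' U))).re :=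
    partitionFn_spinSector_re_pos (hubbardOpenBoxTT'_isHermitian a a t t' U) β
  have hq0 : 0 < (partitionFn β (spinSectorHamiltonian q q (hubbardOpenBoxTT' a a t t' U))).re :=
    partitionFn_spinSector_re_pos (hubbardOpenBoxTT'_isHermitian a a t t' U) β
  have h := pow_mul_pow_partitionFn_openBox_le_rectTorus_allTori a K r hK hrK ha t t' U hβ p q hm
  have hlog := Real.log_le_log (mul_pos (pow_pos hq0 _) (pow_pos hp0 _)) h
  rw [Real.log_mul (pow_pos hq0 _).ne' (pow_pos hp0 _).ne', Real.log_pow, Real.log_pow] at hlog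
  exact hlog

end AllTori

/-! ### §2 Bookkeeping: `L = Ka + r = (K − r)·a + r·(a+1)`; block count versus area; sector range -/

section Bookkeeping

/-- **Every `L ≥ a(a+1)` is two-scale**: with `K = L / a`, `r = L mod a` one has `L = (K − r)·a + r·(a+1)`,
`K − r ≥ 2`, `r ≤ K`, `r < a` (`a ≥ 1`). [cite: Ruelle1969, §3.3 (3.11)–(3.18)] -/
theorem twoScale_decomposition {a L : ℕ} (ha : 1 ≤ a) (hL : a * (a + 1) ≤ L) :
    2 ≤ L / a - L % a ∧ L % a ≤ L / a ∧ L % a < a ∧ L = (L / a - L % a) * a + L % a * (a + 1) := by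
  have ha0 : 0 < a := ha
  have hr : L % a < a := Nat.mod_lt L ha0
  have hK : a + 1 ≤ L / a := (Nat.le_div_iff_mul_le ha0).2 (by rw [mul_comm]; exact hL)
  have hdm : a * (L / a) + L % a = L := Nat.div_add_mod L a
  refine ⟨by omega, by omega, hr, ?_⟩
  obtain ⟨d, hd⟩ := Nat.exists_eq_add_of_le (show L % a ≤ L / a by omega)
  rw [hd, Nat.add_sub_cancel_left]
  rw [hd] at hdm
  calc L = a * (L % a + d) + L % a := hdm.symm
    _ = d * a + L % a * (a + 1) := by ring

/-- The two-scale side: `L = (K − r)·a + r·(a+1) = Ka + r` (`r ≤ K`), as real numbers: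
`K·a ≤ L < (K+1)·a` when `r < a`. [cite: Ruelle1969, §3.3 (3.11)–(3.18)] -/
theorem twoScale_side_bounds {a K r L : ℕ} (hrK : r ≤ K) (hr : r < a)
    (hL : L = (K - r) * a + r * (a + 1)) :
    (K : ℝ) * a ≤ L ∧ (L : ℝ) < ((K : ℝ) + 1) * a := by
  have hKar : L = K * a + r := by
    obtain ⟨d, hd⟩ := Nat.exists_eq_add_of_le hrK
    rw [hL, hd, Nat.add_sub_cancel_left]; ring
  rw [hKar]; push_cast
  have hr' : (r : ℝ) < a := by exact_mod_cast hr
  have hr0 : (0 : ℝ) ≤ r := Nat.cast_nonneg r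
  constructor <;> nlinarith

/-- **Block count versus area**: for the two-scale side, `0 ≤ L²/a² − K² ≤ 2L/a` (`a ≥ 1`, `K ≥ 1`).
[cite: Ruelle1969, §3.3 (3.11)–(3.18)] -/
theorem twoScale_sq_bounds {a K r L : ℕ} (ha : 1 ≤ a) (hK1 : 1 ≤ K) (hrK : r ≤ K) (hr : r < a)
    (hL : L = (K - r) * a + r * (a + 1)) :
    (K : ℝ) * K * (a : ℝ) ^ 2 ≤ (L : ℝ) ^ 2 ∧ (L : ℝ) ^ 2 - 2 * (L : ℝ) * a ≤ (K : ℝ) * K * (a : ℝ) ^ 2 := by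
  obtain ⟨h1, h2⟩ := twoScale_side_bounds hrK hr hL
  have ha0 : (0 : ℝ) < a := by exact_mod_cast ha
  have hK0 : (1 : ℝ) ≤ K := by exact_mod_cast hK1
  have hL0 : (0 : ℝ) ≤ L := Nat.cast_nonneg L
  constructor
  · have h3 : (K : ℝ) * a * ((K : ℝ) * a) ≤ (L : ℝ) * L := mul_le_mul h1 h1 (by positivity) hL0
    nlinarith [h3]
  · -- `L < (K+1)a` ⇒ `L − a < Ka` ⇒ `(L − a)² < (Ka)²` when `L ≥ a`, and `L² − 2La ≤ (L − a)²`
    have hLa : (a : ℝ) ≤ L := by nlinarith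
    nlinarith [mul_nonneg (sub_nonneg.mpr hLa) (sub_nonneg.mpr hLa)]

/-- **Sector range, lower end, every `L`**: `2p/a² ≤ n` and `K·a ≤ L` give `K²p ≤ halfRectN n L`.
[cite: LeBlancEtAl2015, eq. (1)] -/
theorem sq_mul_le_halfRectN_of_mul_le {a p K L : ℕ} (ha : 1 ≤ a) (hKa : (K : ℝ) * a ≤ L) {n : ℝ}
    (hn : 2 * (p : ℝ) / (a : ℝ) ^ 2 ≤ n) : K * K * p ≤ halfRectN n L := by
  unfold halfRectN
  refine Nat.le_floor ?_
  have ha0 : (0 : ℝ) < (a : ℝ) := by exact_mod_cast ha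
  have ha' : (0 : ℝ) < (a : ℝ) ^ 2 := by positivity
  rw [div_le_iff₀ ha'] at hn
  push_cast
  have hK0 : (0 : ℝ) ≤ (K : ℝ) * a := by positivity
  have h1 : ((K : ℝ) * a) ^ 2 ≤ (L : ℝ) ^ 2 := pow_le_pow_left₀ hK0 hKa 2
  have hp0 : (0 : ℝ) ≤ p := Nat.cast_nonneg p
  -- `K²p·a² = p (Ka)² ≤ p L² ≤ n a² L²/2`
  have key : (K : ℝ) * K * p * (a : ℝ) ^ 2 ≤ n * (L : ℝ) ^ 2 / 2 * (a : ℝ) ^ 2 := by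
    nlinarith [mul_le_mul_of_nonneg_left h1 hp0, mul_le_mul_of_nonneg_left hn (sq_nonneg (L : ℝ))]
  exact le_of_mul_le_mul_right key ha'

/-- **Sector range, upper end, all large `L`**: for `n < 2(p+1)/a²` (`a ≥ 1`), eventually in `L`,
`halfRectN n L ≤ (L/a)²·(p+1)` (`L/a` the integer quotient; any real `n`): the blocks of the two-scale tiling
can absorb the electrons with at most `p + 1` per spin each. [cite: LeBlancEtAl2015, eq. (1)] -/
theorem eventually_halfRectN_le_sq_div_mul_succ {a p : ℕ} (ha : 1 ≤ a) {n : ℝ}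
    (hn : n < 2 * ((p : ℝ) + 1) / (a : ℝ) ^ 2) :
    ∀ᶠ L : ℕ in atTop, halfRectN n L ≤ L / a * (L / a) * (p + 1) := by
  have ha0 : (0 : ℝ) < (a : ℝ) := by exact_mod_cast ha
  have ha' : (0 : ℝ) < (a : ℝ) ^ 2 := by positivity
  rw [lt_div_iff₀ ha'] at hn
  -- `δ = (p+1) − n a²/2 > 0`
  set δ : ℝ := ((p : ℝ) + 1) - n * (a : ℝ) ^ 2 / 2 with hδ
  have hδ0 : 0 < δ := by rw [hδ]; linarith
  refine Filter.eventually_atTop.2 ⟨max a (⌈2 * ((p : ℝ) + 1) * a / δ⌉₊), fun L hL => ?_⟩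
  have hLa : a ≤ L := le_trans (le_max_left _ _) hL
  have hLc : (⌈2 * ((p : ℝ) + 1) * a / δ⌉₊ : ℝ) ≤ L := by exact_mod_cast le_trans (le_max_right _ _) hL
  have hL1 : 2 * ((p : ℝ) + 1) * a / δ ≤ L := le_trans (Nat.le_ceil _) hLc
  rw [div_le_iff₀ hδ0] at hL1
  -- the integer quotient: `L/a > L/a − 1` (reals)
  set K := L / a with hK
  have hdm : a * K + L % a = L := Nat.div_add_mod L a
  have hmod : L % a < a := Nat.mod_lt L ha
  have hKR : (L : ℝ) < ((K : ℝ) + 1) * a := by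
    have : (L : ℝ) = a * K + (L % a : ℕ) := by exact_mod_cast hdm.symm
    rw [this]
    have hm : ((L % a : ℕ) : ℝ) < a := by exact_mod_cast hmod
    nlinarith
  have hK1 : (1 : ℝ) ≤ K := by
    have : 1 ≤ K := (Nat.le_div_iff_mul_le ha).2 (by rw [one_mul]; exact hLa)
    exact_mod_cast this
  -- real inequality `n L²/2 ≤ (p+1) K²`
  have hLR : (a : ℝ) ≤ L := by exact_mod_cast hLa
  have key : n * (L : ℝ) ^ 2 / 2 ≤ ((K : ℝ) * K * (p + 1)) := by
    -- `(p+1)(Ka)² > (p+1)(L − a)² = (p+1)(L² − 2La + a²) ≥ (p+1)L² − 2(p+1)La` and `δL² ≥ 2(p+1)a·L`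
    have h1 : ((L : ℝ) - a) < (K : ℝ) * a := by nlinarith
    have h2 : 0 ≤ (L : ℝ) - a := sub_nonneg.mpr hLR
    have h3 : ((L : ℝ) - a) ^ 2 ≤ ((K : ℝ) * a) ^ 2 := by nlinarith
    have h4 : δ * (L : ℝ) ^ 2 ≥ 2 * ((p : ℝ) + 1) * a * L := by nlinarith
    have hp1 : (0 : ℝ) ≤ (p : ℝ) + 1 := by positivity
    -- multiply the target by `a² > 0`
    have key' : n * (L : ℝ) ^ 2 / 2 * (a : ℝ) ^ 2 ≤ (K : ℝ) * K * (p + 1) * (a : ℝ) ^ 2 := by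
      have e1 : (K : ℝ) * K * (p + 1) * (a : ℝ) ^ 2 = ((p : ℝ) + 1) * ((K : ℝ) * a) ^ 2 := by ring
      have e2 : n * (L : ℝ) ^ 2 / 2 * (a : ℝ) ^ 2 = ((p : ℝ) + 1) * (L : ℝ) ^ 2 - δ * (L : ℝ) ^ 2 := by
        rw [hδ]; ring
      rw [e1, e2]
      nlinarith [mul_le_mul_of_nonneg_left h3 hp1]
    exact le_of_mul_le_mul_right key' ha'
  unfold halfRectN
  calc ⌊n * (L : ℝ) ^ 2 / 2⌋₊ ≤ ⌊((K * K * (p + 1) : ℕ) : ℝ)⌋₊ := Nat.floor_le_floor (by push_cast; exact key)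
    _ = K * K * (p + 1) := Nat.floor_natCast _

end Bookkeeping

/-! ### §3 The chord bound on every large torus (`O(L)` defect) -/

section Chord

/-- **The canonical free energy of EVERY large torus lies below the chord of two box free energies at every
filling of the interval, with an `O(L)` defect.** Let `L = (K − r)·a + r·(a+1)` (`K − r ≥ 2`, `r ≤ K`, `r < a`,
`a ≥ 1`), `p + 1 ≤ a²`, `0 ≤ n`, and suppose the sector fits the blocks, `K²p ≤ halfRectN n L ≤ K²(p+1)` (§2:
always at the lower end for `2p/a² ≤ n`, eventually at the upper end for `n < 2(p+1)/a²`). Then for certified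
box floors `0 < z_p ≤ Re Z_β(box; p,p)`, `0 < z_q ≤ Re Z_β(box; p+1,p+1)` (`β ≥ 0`):
`chord(n)·L² − (2/a)·|log z_p − p(log z_q − log z_p)|·L − |log z_q − log z_p| ≤ log Re Z_β(sectorHamiltonianTT' t t' U n L)`,
`chord(n) = (log z_p + (na²/2 − p)(log z_q − log z_p))/a²`. [cite: Ruelle1969, §3.3 (3.11)–(3.18)]
[cite: Israel1979, Lemma II.3.1] -/
theorem chord_mul_sq_sub_linear_le_log_partitionFn_sectorHamiltonianTT' (t t' U : ℝ) {β : ℝ}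
    (hβ : 0 ≤ β) {a p K r L : ℕ} (ha : 1 ≤ a) (hK : 2 ≤ K - r) (hrK : r ≤ K) (hr : r < a)
    (hL : L = (K - r) * a + r * (a + 1)) (hp : p + 1 ≤ a * a) {n : ℝ} (hn0 : 0 ≤ n)
    (hklo : K * K * p ≤ halfRectN n L) (hkhi : halfRectN n L ≤ K * K * (p + 1))
    {zp zq : ℝ} (hzp0 : 0 < zp)
    (hzp : zp ≤ (partitionFn β (spinSectorHamiltonian p p (hubbardOpenBoxTT' a a t t' U))).re)
    (hzq0 : 0 < zq)
    (hzq : zq ≤ (partitionFn β (spinSectorHamiltonian (p + 1) (p + 1) (hubbardOpenBoxTT' a a t t' U))).re) :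
    (Real.log zp + (n * (a : ℝ) ^ 2 / 2 - p) * (Real.log zq - Real.log zp)) / (a : ℝ) ^ 2 * (L : ℝ) ^ 2 -
          2 / (a : ℝ) * |Real.log zp - p * (Real.log zq - Real.log zp)| * L -
        |Real.log zq - Real.log zp| ≤
      Real.log (partitionFn β (sectorHamiltonianTT' t t' U n L)).re := by
  -- the electrons above `K²p`
  obtain ⟨d, hd⟩ := Nat.exists_eq_add_of_le hklo
  have hdle : d ≤ K * K := by
    have h1 : K * K * p + d ≤ K * K * p + K * K := by
      calc K * K * p + d = halfRectN n L := hd.symm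
        _ ≤ K * K * (p + 1) := hkhi
        _ = K * K * p + K * K := by ring
    exact Nat.le_of_add_le_add_left h1
  have hsec : (K * K - d) * p + d * (p + 1) = halfRectN n L := by
    have h1 : K * K - d + d = K * K := Nat.sub_add_cancel hdle
    calc (K * K - d) * p + d * (p + 1) = (K * K - d + d) * p + d := by ring
      _ = K * K * p + d := by rw [h1]
      _ = halfRectN n L := hd.symm
  -- the mixed two-box bound on the torus `L × L`
  have h := mul_log_add_mul_log_partitionFn_openBox_le_rectTorus_allTori a K r hK hrK ha t t' U hβ
    (p := p) (q := p + 1) (by omega) hp hdle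
  rw [hsec, ← hL, ← partitionFn_spinSector_hubbardTorusTT'_eq_rect,
    ← partitionFn_sectorHamiltonianTT'_eq_spinSector] at h
  -- abbreviations and the certified floors
  set x := Real.log zp with hx
  set y := Real.log zq with hy
  have hxle : x ≤ Real.log (partitionFn β (spinSectorHamiltonian p p (hubbardOpenBoxTT' a a t t' U))).re :=
    Real.log_le_log hzp0 hzp
  have hyle : y ≤
      Real.log (partitionFn β (spinSectorHamiltonian (p + 1) (p + 1) (hubbardOpenBoxTT' a a t t' U))).re :=
    Real.log_le_log hzq0 hzq
  have hcoef : ((K * K - d : ℕ) : ℝ) = (K : ℝ) * K - d := by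
    rw [Nat.cast_sub hdle]; push_cast; ring
  rw [hcoef] at h
  have hKd : (0 : ℝ) ≤ (K : ℝ) * K - d := by
    have : ((d : ℕ) : ℝ) ≤ ((K * K : ℕ) : ℝ) := by exact_mod_cast hdle
    push_cast at this; linarith
  have hmono : (d : ℝ) * y + ((K : ℝ) * K - d) * x ≤
      Real.log (partitionFn β (sectorHamiltonianTT' t t' U n L)).re :=
    le_trans (add_le_add (mul_le_mul_of_nonneg_left hyle (Nat.cast_nonneg d))
      (mul_le_mul_of_nonneg_left hxle hKd)) h
  -- geometry of the two-scale side and the sector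
  have hK1 : 1 ≤ K := by omega
  obtain ⟨hKa, hLlt⟩ := twoScale_side_bounds hrK hr hL
  obtain ⟨hsq1, hsq2⟩ := twoScale_sq_bounds ha hK1 hrK hr hL
  obtain ⟨hδ0, hδ1⟩ := halfRectN_floor_bounds hn0 L
  have ha0 : (0 : ℝ) < (a : ℝ) := by exact_mod_cast ha
  have ha2 : (a : ℝ) ^ 2 ≠ 0 := by positivity
  have hkR : ((halfRectN n L : ℕ) : ℝ) = (K : ℝ) * K * p + d := by rw [hd]; push_cast; ring
  -- `Δ = L²/a² − K² ∈ [0, 2L/a]`, `δ = nL²/2 − k ∈ [0, 1)`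
  set Δ : ℝ := (L : ℝ) ^ 2 / (a : ℝ) ^ 2 - (K : ℝ) * K with hΔ
  have hΔ0 : 0 ≤ Δ := by
    rw [hΔ, sub_nonneg, le_div_iff₀ (by positivity)]; exact hsq1
  have hΔle : Δ ≤ 2 * (L : ℝ) / a := by
    rw [hΔ, sub_le_iff_le_add, div_le_iff₀ (by positivity)]
    have e : (2 * (L : ℝ) / a + (K : ℝ) * K) * (a : ℝ) ^ 2 = 2 * (L : ℝ) * a + (K : ℝ) * K * (a : ℝ) ^ 2 := by
      field_simp
    rw [e]; linarith
  set δ' : ℝ := n * (L : ℝ) ^ 2 / 2 - (halfRectN n L : ℝ) with hδ'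
  -- the identity behind the chord
  have e : (d : ℝ) * y + ((K : ℝ) * K - d) * x =
      (x + (n * (a : ℝ) ^ 2 / 2 - p) * (y - x)) / (a : ℝ) ^ 2 * (L : ℝ) ^ 2 -
        Δ * (x - p * (y - x)) - δ' * (y - x) := by
    have hdR : (d : ℝ) = (halfRectN n L : ℝ) - (K : ℝ) * K * p := by rw [hkR]; ring
    rw [hdR, hΔ, hδ']
    field_simp
    ring
  -- the two defect terms
  have hD1 : Δ * (x - p * (y - x)) ≤ 2 / (a : ℝ) * |x - p * (y - x)| * L := by
    calc Δ * (x - p * (y - x)) ≤ Δ * |x - p * (y - x)| :=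
          mul_le_mul_of_nonneg_left (le_abs_self _) hΔ0
      _ ≤ (2 * (L : ℝ) / a) * |x - p * (y - x)| := mul_le_mul_of_nonneg_right hΔle (abs_nonneg _)
      _ = 2 / (a : ℝ) * |x - p * (y - x)| * L := by ring
  have hD0 : δ' * (y - x) ≤ |y - x| := by
    calc δ' * (y - x) ≤ |δ' * (y - x)| := le_abs_self _
      _ = δ' * |y - x| := by rw [abs_mul, abs_of_nonneg hδ0]
      _ ≤ 1 * |y - x| := mul_le_mul_of_nonneg_right hδ1.le (abs_nonneg _)
      _ = |y - x| := one_mul _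
  linarith [hmono, e, hD1, hD0]

end Chord

end Literature.MathematicalPhysics.QuantumLattice
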